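import Mathlib
import HarnessLib
import Summits.RiemannHypothesis.RiemannHypothesis.Theses.WeilParity
import Summits.RiemannHypothesis.RiemannHypothesis.Theorems.WeilParityEvenWinsBeyondArchStubSectorContinuity
import Summits.RiemannHypothesis.RiemannHypothesis.Theorems.WeilParityEvenWinsBeyondArchStubOnePrimeWindow
import Literature.NumberTheory.LFunctions.WeilGroundEnergyParitySplit
import Literature.NumberTheory.LFunctions.WeilWindowSimpleEven

/-!
# Line `split` — the crux `EvenWinsBeyondArch` (stmt-RiemannHypothesis-15432) from its two ROUTE-LEVEL
# pieces: the one-prime window (RH-free, certifiable) and "no parity crossing" beyond it (RH residue)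

Route `WeilParity` (route-RiemannHypothesis-WeilParity), crux #3 `EvenWinsBeyondArch`: on every window
`a > (log 2)/2` every odd `L²`-normalised Weil test on `[-a, a]` is matched, up to any `δ > 0`, by an even
one — `ε_ev(a) ≤ ε_od(a)` (`weilEvenGroundEnergy`, `weilOddGroundEnergy`).

## THE LINE (strategist, RESTATED re-exam 2026-08-17): anchor-and-propagate from the ONE-PRIME WINDOW

Two registered stubs, which are ALSO filed as crux items of the route (same statements verbatim), so
that the crux is DERIVED from route leaves:

* `stub_onePrimeWindowSimpleEven` — for `(log 2)/2 < a ≤ (log 3)/2` (exactly one prime power, `2`,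
  enters Weil's windowed form) the bottom is simple, isolated and even: `WeilWindowSimpleEven a`
  (Connes–van Suijlekom clause).  RH-FREE and CERTIFIABLE by the landed cell-transfer method of the
  sister crux `GroundStateSimpleEven` (`GroundStateSimpleEven.weilWindowSimpleEven_on_cell_of_le`,
  `Theorems/WeilGroundStateGroundStateSimpleEvenCellTransfer.lean`): per cell `[b, c]` one even trial
  upper bound `U ≥ ε(b)` and one certified odd-sector lower bound `L > U` at window `c`.  Numerics
  (`Cruxes/GroundStateSimpleEven/Disproof.lean`, kit j016728/j016733): `e1 = 1.33e-3 → 1.8e-4 →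
  9.4e-7 → ≈4e-8`, `o1/e1 = 55 → 81 → 208 → ≈250` at `a = (log 2)/2, 0.4, 0.5, (log 3)/2`; the four
  cells `{(log 2)/2, 2/5, 9/20, 1/2, (log 3)/2}` each have `ε(b) < ε_od(c)` with margin ≈ 10×
  (line `cells` of the piece).  Size L–XL (certified odd lower bounds at the 1e-5 level).
* `stub_noParityCrossing` — for `a > (log 3)/2` the sector bottoms never tie, `ε_ev(a) ≠ ε_od(a)`.
  The RH-bearing residue, stated parity-SYMMETRICALLY (it does not say which sector wins): under
  `¬RH`, `OffLineParityDetection` + sector continuity force a tie; under RH it is Connes' picture.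
  Size: open problem (line `ladder` of the piece: certified `{2,3}`-window + Connes' clause on the tail).

Composition (sorry-free, standard axioms): on the one-prime window stub 1 gives the STRICT order
(`weilEvenGroundEnergy_lt_weilOddGroundEnergy_of_weilWindowSimpleEven`); beyond `(log 3)/2` both
sector bottoms are continuous in the window (LANDED: `Theorems.stub_sectorContinuity`, Bombieri 2000
Thm 5 per sector), the order is strict at the anchor `(log 3)/2` (stub 1 at its right endpoint), and a
reversal would force a tie (IVT), excluded by stub 2; `ε_ev ≤ ε_od` converts to the junk-free crux
(`evenWinsBeyondArch_of_forall_le`).  Why it dodges the stuck point of line `birth`: birth's open stub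
`stub_bottomSimpleBeyondArch` mixes the certifiable range with the RH tail in ONE statement anchored at
`(log 2)/2`; here the certifiable one-prime window is its own stub/item (cells are delegable now) and
the residue starts where certification must stop being routine.  The same file, minus the two `sorry`s,
is the evidence `WeilParityEvenWinsBeyondArchSplit.lean` on the crux item (theorem
`Theorems.evenWinsBeyondArch_of_subs`, lean check rc 0) awaiting a prover to land it.

Disproof used: no `Disproof.lean` / `Negative/*` exists for this crux (`ledger crux ls`, 2026-08-17);
negatives index of the summit (2 entries, CharacterSums / UniversalFactor) unrelated.  Dead lines: none
recorded; line `birth` is alive (its stub 1 landed) and is subsumed: birth's stub 2 implies stub 2 here.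
-/

set_option linter.dupNamespace false
set_option linter.unusedVariables false

noncomputable section

namespace Summit.RiemannHypothesis.RiemannHypothesis.Cruxes.EvenWinsBeyondArch.Split

open MeasureTheory Set Filter
open scoped Real Topology ComplexConjugate
open Literature.NumberTheory.LFunctions
open Summit.RiemannHypothesis.RiemannHypothesis.Theses.WeilParity

/-! ## The two registered stubs (= the route-level pieces, verbatim)

STATUS (lead c1, 2026-08-17): stub 1 `stub_onePrimeWindowSimpleEven` is CLOSED (landed Theorems decl,
composition of the sister crux `GroundStateSimpleEven`'s certified cells); the ONLY remaining `sorry` is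
stub 2 `stub_noParityCrossing` = route item 18085, the RH-bearing residue. -/

/-- **Stub 1 — the ONE-PRIME PARITY THEOREM** (piece `OnePrimeWindowSimpleEven`): on every window
`(log 2)/2 < a ≤ (log 3)/2` the bottom of Weil's windowed form is simple, isolated and even
(`WeilWindowSimpleEven a`). RH-free; certifiable by cell transfer (line `cells`).
[cite: ConnesSuijlekom2025, Thm. 6.1 (hypothesis)] -/
theorem stub_onePrimeWindowSimpleEven :
    ∀ a : ℝ, Real.log 2 / 2 < a → a ≤ Real.log 3 / 2 →
      Literature.NumberTheory.LFunctions.WeilWindowSimpleEven a :=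
  -- CLOSED (lead c1, 2026-08-17): the landed Theorems decl (composition of the sister crux 1526's
  -- eight certified cell bounds with the cell transfer), file
  -- Theorems/WeilParityEvenWinsBeyondArchStubOnePrimeWindow.lean.
  Summit.RiemannHypothesis.RiemannHypothesis.Theorems.stub_onePrimeWindowSimpleEven

/-- **Stub 2 — NO PARITY LEVEL-CROSSING beyond the one-prime window** (piece `NoParityCrossing`):
for `a > (log 3)/2` the even and odd sector bottoms never coincide. RH-strength residue,
parity-symmetric. [cite: Connes2026Letter, §6.6] -/
theorem stub_noParityCrossing :
    ∀ a : ℝ, Real.log 3 / 2 < a →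
      Literature.NumberTheory.LFunctions.weilEvenGroundEnergy a ≠
        Literature.NumberTheory.LFunctions.weilOddGroundEnergy a := by
  sorry

/-! ## Sorry-free infrastructure -/

/-- `0 < (log 2)/2`. [folklore] -/
theorem log_two_half_pos : 0 < Real.log 2 / 2 :=
  div_pos (Real.log_pos one_lt_two) two_pos

/-- `(log 2)/2 < (log 3)/2`. [folklore] -/
theorem log_two_half_lt_log_three_half : Real.log 2 / 2 < Real.log 3 / 2 :=
  div_lt_div_of_pos_right (Real.log_lt_log two_pos (by norm_num)) two_pos

/-- **`WeilWindowSimpleEven a` forces `ε_ev(a) < ε_od(a)`** (`a > 0`): odd normalised window tests are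
bounded below by `ε(a) + δ`, so `ε_od ≥ ε + δ > ε = min(ε_ev, ε_od)`. [folklore] -/
theorem weilEvenGroundEnergy_lt_weilOddGroundEnergy_of_weilWindowSimpleEven {a : ℝ} (ha : 0 < a)
    (h : WeilWindowSimpleEven a) : weilEvenGroundEnergy a < weilOddGroundEnergy a := by
  obtain ⟨φ, δ, hδ, hgap⟩ := h
  have hodd : weilGroundEnergy a + δ ≤ weilOddGroundEnergy a :=
    le_weilOddGroundEnergy_of_forall ha fun g hg hs ho hn ↦ hgap g hg hs hn (Or.inl ho)
  have hmin := weilGroundEnergy_eq_min_even_odd a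
  rcases min_cases (weilEvenGroundEnergy a) (weilOddGroundEnergy a) with ⟨h1, h2⟩ | ⟨h1, h2⟩
  · rw [hmin, h1] at hodd
    linarith
  · rw [hmin, h1] at hodd
    linarith

/-- **IVT propagation across the parity sectors** from an anchor `a₁ > 0`: continuity of both sector
bottoms on `(0, ∞)`, strict order at `a₁`, and no tie on `(a₁, ∞)` give `ε_ev(a) < ε_od(a)` for every
`a > a₁`. [folklore] -/
theorem weilEvenGroundEnergy_lt_weilOddGroundEnergy_of_noCrossing {a₁ : ℝ} (ha₁ : 0 < a₁)
    (hcont : ContinuousOn weilEvenGroundEnergy (Set.Ioi (0 : ℝ)) ∧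
      ContinuousOn weilOddGroundEnergy (Set.Ioi (0 : ℝ)))
    (hanchor : weilEvenGroundEnergy a₁ < weilOddGroundEnergy a₁)
    (hne : ∀ a : ℝ, a₁ < a → weilEvenGroundEnergy a ≠ weilOddGroundEnergy a)
    {a : ℝ} (ha : a₁ < a) :
    weilEvenGroundEnergy a < weilOddGroundEnergy a := by
  set d : ℝ → ℝ := fun x ↦ weilOddGroundEnergy x - weilEvenGroundEnergy x with hd
  have hsub : Set.Icc a₁ a ⊆ Set.Ioi 0 := fun x hx ↦ lt_of_lt_of_le ha₁ hx.1
  have hdcont : ContinuousOn d (Set.Icc a₁ a) :=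
    (hcont.2.mono hsub).sub (hcont.1.mono hsub)
  have hd₁ : 0 < d a₁ := sub_pos.mpr hanchor
  have hda : d a ≠ 0 := by
    intro h0
    apply hne a ha
    simp only [hd] at h0
    linarith
  rcases lt_or_gt_of_ne hda with hneg | hpos
  · exfalso
    obtain ⟨c, hc, hdc⟩ := intermediate_value_Icc' ha.le hdcont ⟨hneg.le, hd₁.le⟩
    have hca₁ : c ≠ a₁ := by
      intro hEq
      rw [hEq] at hdc
      linarith
    have hc' : a₁ < c := lt_of_le_of_ne hc.1 (Ne.symm hca₁)
    apply hne c hc'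
    simp only [hd] at hdc
    linarith
  · exact sub_pos.mp hpos

/-- **From `ε_ev ≤ ε_od` to the junk-free crux** (conclusion = `EvenWinsBeyondArch` unfolded).
[folklore] -/
theorem evenWinsBeyondArch_of_forall_le
    (h : ∀ a : ℝ, Real.log 2 / 2 < a → weilEvenGroundEnergy a ≤ weilOddGroundEnergy a) :
    ∀ a : ℝ, Real.log 2 / 2 < a → ∀ o : ℝ → ℂ, Literature.NumberTheory.LFunctions.IsWeilTest o →
      tsupport o ⊆ Set.Icc (-a) a → (∀ t, o (-t) = -o t) → ∫ t, ‖o t‖ ^ 2 = (1 : ℝ) → ∀ δ : ℝ, 0 < δ →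
        ∃ e : ℝ → ℂ, Literature.NumberTheory.LFunctions.IsWeilTest e ∧ tsupport e ⊆ Set.Icc (-a) a ∧
          (∀ t, e (-t) = e t) ∧ ∫ t, ‖e t‖ ^ 2 = (1 : ℝ) ∧
          (Literature.NumberTheory.LFunctions.weilQuadratic e).re ≤
            (Literature.NumberTheory.LFunctions.weilQuadratic o).re + δ := by
  intro a ha o ho hos hodd hon δ hδ
  have ha0 : 0 < a := lt_trans log_two_half_pos ha
  have hod : weilOddGroundEnergy a ≤ (weilQuadratic o).re := weilOddGroundEnergy_le ho hos hodd hon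
  have hlt : sInf (weilWindowSphereValues (fun g ↦ ∀ t, g (-t) = g t) a) < (weilQuadratic o).re + δ := by
    rw [← weilEvenGroundEnergy_eq_sInf]
    linarith [h a ha]
  obtain ⟨x, hxS, hx⟩ := exists_lt_of_csInf_lt (weilWindowSphereValues_even_nonempty ha0) hlt
  obtain ⟨e, he, hes, hev, hen, rfl⟩ := hxS
  exact ⟨e, he, hes, hev, hen, hx.le⟩

/-! ## The composition: the two stubs prove the crux BY NAME -/

/-- **Composition with explicit hypotheses** (`stub₁-sig → stub₂-sig → crux unfolded`): strict order on
the one-prime window from stub 1; beyond `(log 3)/2` by IVT propagation from the anchor `(log 3)/2`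
(stub 1 at its right endpoint) using the LANDED sector continuity `Theorems.stub_sectorContinuity` and
stub 2; then `evenWinsBeyondArch_of_forall_le`. Sorry-free, standard axioms. [folklore] -/
theorem evenWinsBeyondArch_of_stubs
    (h₁ : ∀ a : ℝ, Real.log 2 / 2 < a → a ≤ Real.log 3 / 2 →
      Literature.NumberTheory.LFunctions.WeilWindowSimpleEven a)
    (h₂ : ∀ a : ℝ, Real.log 3 / 2 < a →
      Literature.NumberTheory.LFunctions.weilEvenGroundEnergy a ≠
        Literature.NumberTheory.LFunctions.weilOddGroundEnergy a) :
    ∀ a : ℝ, Real.log 2 / 2 < a → ∀ o : ℝ → ℂ, Literature.NumberTheory.LFunctions.IsWeilTest o →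
      tsupport o ⊆ Set.Icc (-a) a → (∀ t, o (-t) = -o t) → ∫ t, ‖o t‖ ^ 2 = (1 : ℝ) → ∀ δ : ℝ, 0 < δ →
        ∃ e : ℝ → ℂ, Literature.NumberTheory.LFunctions.IsWeilTest e ∧ tsupport e ⊆ Set.Icc (-a) a ∧
          (∀ t, e (-t) = e t) ∧ ∫ t, ‖e t‖ ^ 2 = (1 : ℝ) ∧
          (Literature.NumberTheory.LFunctions.weilQuadratic e).re ≤
            (Literature.NumberTheory.LFunctions.weilQuadratic o).re + δ := by
  refine evenWinsBeyondArch_of_forall_le fun a ha ↦ le_of_lt ?_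
  rcases le_or_gt a (Real.log 3 / 2) with hle | hlt
  · exact weilEvenGroundEnergy_lt_weilOddGroundEnergy_of_weilWindowSimpleEven
      (log_two_half_pos.trans ha) (h₁ a ha hle)
  · have h23 := log_two_half_lt_log_three_half
    have hanchor : weilEvenGroundEnergy (Real.log 3 / 2) < weilOddGroundEnergy (Real.log 3 / 2) :=
      weilEvenGroundEnergy_lt_weilOddGroundEnergy_of_weilWindowSimpleEven (log_two_half_pos.trans h23)
        (h₁ _ h23 le_rfl)
    exact weilEvenGroundEnergy_lt_weilOddGroundEnergy_of_noCrossing (log_two_half_pos.trans h23)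
      Summit.RiemannHypothesis.RiemannHypothesis.Theorems.stub_sectorContinuity hanchor h₂ hlt

/-- **THE SKELETON THEOREM.** The crux
`Summit.RiemannHypothesis.RiemannHypothesis.Theses.WeilParity.EvenWinsBeyondArch`, concluded BY NAME
from the two DECLARED stubs `stub_onePrimeWindowSimpleEven` and `stub_noParityCrossing` (the only
`sorry`s of the file) through the sorry-free composition `evenWinsBeyondArch_of_stubs`. [folklore] -/
theorem EvenWinsBeyondArch_of :
    Summit.RiemannHypothesis.RiemannHypothesis.Theses.WeilParity.EvenWinsBeyondArch :=
  evenWinsBeyondArch_of_stubs stub_onePrimeWindowSimpleEven stub_noParityCrossing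

end Summit.RiemannHypothesis.RiemannHypothesis.Cruxes.EvenWinsBeyondArch.Split

end
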